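import Summits.AtomisticToContinuum.Crystallization.Theorems.FrustratedLawDichotomyCellKitX2
import Summits.AtomisticToContinuum.Crystallization.Theorems.FrustratedLawDichotomyCellKitXKill

/-!
# FrustratedLawDichotomy · crux `AperiodicFrustratedLawGap` (stmt-AtomisticToContinuum-27623) — CELL KIT X, TWO-ZONE MOVE CHECK: soundness
# ★★ `checkMove2 = true ⟹ ¬MoveUnstableCore ε Rm s` (decomp-a2c, prover hand 2, generation 17)

`…CellKitX2.checkMove2 c P s₀ XI X m` discharges every hypothesis of `…CollarNonExemptZones.not_moveUnstableCore_of_twoZone_data`: the inner ball from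
`hrange_of_check` / `hbreg_of_check` at the parameters `innerP P s₀` (same `Rm`, radius `s₀`), `hB`/`hC4` bridges with the inner bins, and the 4×4
certificate `…CollarNonExemptAniso.anisoCert_of_ldl4` fed with `S_lo`, the force enclosures (`hF_enclosure`, `τ = N₀K³/2⁴⁰`) and the pivots of `checkArithIn`;
the outer shell exactly as in `…CellKitXKill.not_moveUnstableCore_of_check` with the shell condition of `checkArithOut`.  All `[folklore]`; 0 sorry.
-/

noncomputable section

namespace Summit.AtomisticToContinuum.Crystallization.Theorems.FrustratedLawDichotomyCellKitX

open scoped BigOperators RealInnerProductSpace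
open Summit.AtomisticToContinuum.Crystallization.Theorems.ChargedEnergyGapNegative (E3)
open Summit.AtomisticToContinuum.Crystallization.Theorems.FrustratedLawDichotomyCellChecker (Cell)
open Summit.AtomisticToContinuum.Crystallization.Theorems.FrustratedLawDichotomyCellKitF (cellμ cellσ cellIdx cellMid)
open Summit.AtomisticToContinuum.Crystallization.Theorems.FrustratedLawDichotomyPeriodicBlockKernel (PerSep)
open Summit.AtomisticToContinuum.Crystallization.Theorems.FrustratedLawDichotomyExemptAbsorptionRecord (MoveUnstableCore)
open Summit.AtomisticToContinuum.Crystallization.Theorems.FrustratedLawDichotomyCollarNonExemptCoords (norm_sum_smul_le_of_coords)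
open Summit.AtomisticToContinuum.Crystallization.Theorems.FrustratedLawDichotomyCollarNonExemptAniso (anisoCert_of_ldl4)
open Summit.AtomisticToContinuum.Crystallization.Theorems.FrustratedLawDichotomyCollarNonExemptBins (hA_of_ldl_lo norm_sum_smul_le_of_enclosures)
open Summit.AtomisticToContinuum.Crystallization.Theorems.FrustratedLawDichotomyCollarNonExemptZones (not_moveUnstableCore_of_twoZone_data)

variable (c : Cell)

/-- `innerP` keeps `Rm` (definitional bookkeeping). [folklore] -/
theorem innerP_Rm (P : XParams) (s0 : ℚ) : (innerP P s0).Rm = P.Rm := rfl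

/-- `innerP` has radius `s₀`. [folklore] -/
theorem innerP_s (P : XParams) (s0 : ℚ) : (innerP P s0).s = s0 := rfl

/-- `innerX` carries the inner bins. [folklore] -/
theorem innerX_bins (XI : XCertIn) : (innerX XI).bins = XI.bins := rfl

set_option maxHeartbeats 800000 in
/-- ★★ **TWO-ZONE MOVE SOUNDNESS** (heartbeats raised: forty cast hypotheses): `checkGeom ∧ checkParams ∧ checkMove2 ⟹ ¬MoveUnstableCore ε Rm s`
at the class centre `cellIdx m`. [folklore] -/
theorem not_moveUnstableCore_of_check2 (hG : c.checkGeom = true) {P : XParams} (hP : checkParams c P = true) {s0 : ℚ} {XI : XCertIn} {X : XCert}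
    {m : Fin c.N₀} (h : checkMove2 c P s0 XI X m = true) :
    ¬ MoveUnstableCore (P.ε : ℝ) (P.Rm : ℝ) (P.s : ℝ) (c.N₀ * c.K3) c.zM (cellIdx c.N₀ c.k₀ m) := by
  obtain ⟨hD, -, hsep, -⟩ := c.geom_sound hG
  have hP' := hP
  simp only [checkParams, Bool.and_eq_true, decide_eq_true_eq] at hP'
  obtain ⟨⟨⟨⟨-, hs0P⟩, hsRm⟩, -⟩, -⟩ := hP'
  have hRm : 0 ≤ P.Rm := (hs0P.trans hsRm).le
  simp only [checkMove2, checkArithIn, checkArithOut, Bool.and_eq_true, decide_eq_true_eq] at h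
  obtain ⟨⟨⟨⟨⟨hbinsI, hcovI⟩, hIn⟩, hbins⟩, hcov⟩,
    ⟨⟨⟨⟨⟨⟨⟨⟨⟨⟨hβ0, hβ⟩, hφ0⟩, hφ⟩, hd0⟩, hd1⟩, hd2⟩, hL⟩, hs00⟩, hvert⟩, hshell⟩⟩ := h
  obtain ⟨⟨⟨⟨⟨⟨⟨⟨⟨⟨⟨⟨⟨⟨⟨⟨hβI0, hβI⟩, hμ0⟩, he0⟩, he1⟩, he2⟩, he3⟩, i00⟩, i01⟩, i02⟩, i03⟩, i11⟩, i12⟩, i13⟩, i22⟩, i23⟩, i33⟩ := hIn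
  -- casts (inner: signs + ten identities; outer: pivots), then the rational sums as real atoms
  have he0R := (Rat.cast_le (K := ℝ)).2 he0
  have he1R := (Rat.cast_le (K := ℝ)).2 he1
  have he2R := (Rat.cast_le (K := ℝ)).2 he2
  have he3R := (Rat.cast_le (K := ℝ)).2 he3
  have i00R := congrArg (Rat.cast : ℚ → ℝ) i00
  have i01R := congrArg (Rat.cast : ℚ → ℝ) i01
  have i02R := congrArg (Rat.cast : ℚ → ℝ) i02
  have i03R := congrArg (Rat.cast : ℚ → ℝ) i03
  have i11R := congrArg (Rat.cast : ℚ → ℝ) i11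
  have i12R := congrArg (Rat.cast : ℚ → ℝ) i12
  have i13R := congrArg (Rat.cast : ℚ → ℝ) i13
  have i22R := congrArg (Rat.cast : ℚ → ℝ) i22
  have i23R := congrArg (Rat.cast : ℚ → ℝ) i23
  have i33R := congrArg (Rat.cast : ℚ → ℝ) i33
  have hd0R := (Rat.cast_lt (K := ℝ)).2 hd0
  have hd1R := (Rat.cast_lt (K := ℝ)).2 hd1
  have hd2R := (Rat.cast_le (K := ℝ)).2 hd2
  have hLR := (Rat.cast_lt (K := ℝ)).2 hL
  have hvertR := (Rat.cast_le (K := ℝ)).2 hvert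
  have hshellR := (Rat.cast_le (K := ℝ)).2 hshell
  rw [Rat.cast_mul, Rat.cast_add, Rat.cast_mul, cast_slackQ] at hshellR
  rw [Rat.cast_sub, Rat.cast_sub, cast_slackQ] at i33R
  push_cast at he0R he1R he2R he3R i00R i01R i02R i03R i11R i12R i13R i22R i23R i33R hd0R hd1R hd2R hLR hvertR hshellR
  set SR := ((sumX c (termS c P m) : ℚ) : ℝ) with hSR
  set F0 := ((sumX c (termF c P 0 m) : ℚ) : ℝ) with hF0
  set F1 := ((sumX c (termF c P 1 m) : ℚ) : ℝ) with hF1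
  set F2 := ((sumX c (termF c P 2 m) : ℚ) : ℝ) with hF2
  set C00 := ((sumX c (termC c P X.bins 0 0 m) : ℚ) : ℝ) with hC00
  set C01 := ((sumX c (termC c P X.bins 0 1 m) : ℚ) : ℝ) with hC01
  set C02 := ((sumX c (termC c P X.bins 0 2 m) : ℚ) : ℝ) with hC02
  set C11 := ((sumX c (termC c P X.bins 1 1 m) : ℚ) : ℝ) with hC11
  set C12 := ((sumX c (termC c P X.bins 1 2 m) : ℚ) : ℝ) with hC12
  set C22 := ((sumX c (termC c P X.bins 2 2 m) : ℚ) : ℝ) with hC22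
  have hτ0 : (0 : ℝ) ≤ ((tauOf c : ℚ) : ℝ) := by unfold tauOf; positivity
  -- common notation
  have hCsq : ∀ (bins : List MoveBin) (a : Fin 3), ((sumX c (termC c P bins a a m) : ℚ) : ℝ) =
      4 * ∑ k ∈ (Finset.univ.erase (cellIdx c.N₀ c.k₀ m)).filter (fun k => dist (c.zM k) (c.zM (cellIdx c.N₀ c.k₀ m)) ≤ (P.Rm : ℝ)),
        ((cOf bins (nq c m k) : ℚ) : ℝ) * (c.zM (cellIdx c.N₀ c.k₀ m) - c.zM k) a ^ 2 := by
    intro bins a; rw [hC_of_check c hD hsep P hRm bins m a a]; congr 1; refine Finset.sum_congr rfl fun k _ => ?_; ring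
  have hC := hC_of_check c hD hsep P hRm
  -- ===== INNER BALL: the anisotropic 4×4 certificate =====
  have hN₀ := anisoCert_of_ldl4 ((Finset.univ.erase (cellIdx c.N₀ c.k₀ m)).filter (fun k => dist (c.zM k) (c.zM (cellIdx c.N₀ c.k₀ m)) ≤ (P.Rm : ℝ)))
    (fun k => ((cOf XI.bins (nq c m k) : ℚ) : ℝ))
    (fun k => -(1 / 2) * (dist (c.zM (cellIdx c.N₀ c.k₀ m)) (c.zM k) ^ 2)⁻¹ ^ 7 + (1 / 2) * (dist (c.zM (cellIdx c.N₀ c.k₀ m)) (c.zM k) ^ 2)⁻¹ ^ 4)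
    (fun k => c.zM (cellIdx c.N₀ c.k₀ m) - c.zM k) (fun a => ((sumX c (termF c P a m) : ℚ) : ℝ))
    (Slo := SR) (beta := (XI.beta : ℝ)) (C4m := min ((sumX c (termC4 c P XI.bins m) : ℚ) : ℝ) 0) (mu := (XI.mu : ℝ)) (s := (s0 : ℝ))
    (γ := (P.ε : ℝ) + P.s * (P.Rm / (P.Rm - P.s)) ^ 7 *
      (6000 / 343 * (P.Rm : ℝ)⁻¹ ^ 4 + 2880 / 49 * (P.Rm : ℝ)⁻¹ ^ 5 + 10 / 7 * (P.Rm : ℝ)⁻¹ ^ 6 + 2 * (P.Rm : ℝ)⁻¹ ^ 7))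
    (τ := ((tauOf c : ℚ) : ℝ)) (l10 := (XI.l10 : ℝ)) (l20 := (XI.l20 : ℝ)) (l21 := (XI.l21 : ℝ)) (l30 := (XI.l30 : ℝ)) (l31 := (XI.l31 : ℝ)) (l32 := (XI.l32 : ℝ))
    (d0 := (XI.d0 : ℝ)) (d1 := (XI.d1 : ℝ)) (d2 := (XI.d2 : ℝ)) (d3 := (XI.d3 : ℝ))
    hτ0 (hS_of_check c hD hsep P hRm m) (fun a => hF_enclosure c hD hsep P hRm m a) he0R he1R he2R he3R
    (by rw [← hCsq XI.bins 0]; linarith [i00R]) (by rw [← hC XI.bins m 0 1]; linarith [i01R]) (by rw [← hC XI.bins m 0 2]; linarith [i02R])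
    (by linarith [i03R]) (by rw [← hCsq XI.bins 1]; linarith [i11R]) (by rw [← hC XI.bins m 1 2]; linarith [i12R])
    (by linarith [i13R]) (by rw [← hCsq XI.bins 2]; linarith [i22R]) (by linarith [i23R]) (by linarith [i33R])
  have hBI := norm_sum_smul_le_of_coords
    ((Finset.univ.erase (cellIdx c.N₀ c.k₀ m)).filter (fun k => dist (c.zM k) (c.zM (cellIdx c.N₀ c.k₀ m)) ≤ (P.Rm : ℝ)))
    (fun k => 4 * ((cOf XI.bins (nq c m k) : ℚ) : ℝ)) (fun k => c.zM (cellIdx c.N₀ c.k₀ m) - c.zM k) (β := (XI.beta : ℝ))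
    (by exact_mod_cast hβI0)
    (by
      rw [← hB_of_check c hD hsep P hRm XI.bins m 0, ← hB_of_check c hD hsep P hRm XI.bins m 1, ← hB_of_check c hD hsep P hRm XI.bins m 2]
      exact_mod_cast hβI)
  have hC4I := hC4_of_check c hD hsep P hRm XI.bins m
  -- ===== OUTER SHELL: the isotropic data =====
  have hA := hA_of_ldl_lo ((Finset.univ.erase (cellIdx c.N₀ c.k₀ m)).filter (fun k => dist (c.zM k) (c.zM (cellIdx c.N₀ c.k₀ m)) ≤ (P.Rm : ℝ)))
    (fun k => ((cOf X.bins (nq c m k) : ℚ) : ℝ))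
    (fun k => -(1 / 2) * (dist (c.zM (cellIdx c.N₀ c.k₀ m)) (c.zM k) ^ 2)⁻¹ ^ 7 + (1 / 2) * (dist (c.zM (cellIdx c.N₀ c.k₀ m)) (c.zM k) ^ 2)⁻¹ ^ 4)
    (fun k => c.zM (cellIdx c.N₀ c.k₀ m) - c.zM k) (Slo := SR) (lam := (X.lam : ℝ))
    (l10 := C01 / (SR + C00 - X.lam)) (l20 := C02 / (SR + C00 - X.lam))
    (l21 := (C12 - C02 / (SR + C00 - X.lam) * (C01 / (SR + C00 - X.lam)) * (SR + C00 - X.lam)) /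
      (SR + C11 - X.lam - (C01 / (SR + C00 - X.lam)) ^ 2 * (SR + C00 - X.lam)))
    (d0 := SR + C00 - X.lam) (d1 := SR + C11 - X.lam - (C01 / (SR + C00 - X.lam)) ^ 2 * (SR + C00 - X.lam))
    (d2 := SR + C22 - X.lam - (C02 / (SR + C00 - X.lam)) ^ 2 * (SR + C00 - X.lam) -
      ((C12 - C02 / (SR + C00 - X.lam) * (C01 / (SR + C00 - X.lam)) * (SR + C00 - X.lam)) /
        (SR + C11 - X.lam - (C01 / (SR + C00 - X.lam)) ^ 2 * (SR + C00 - X.lam))) ^ 2 *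
        (SR + C11 - X.lam - (C01 / (SR + C00 - X.lam)) ^ 2 * (SR + C00 - X.lam)))
    (hS_of_check c hD hsep P hRm m) hd0R.le hd1R.le hd2R
    (by rw [← hCsq X.bins 0]) (by rw [← hC X.bins m 0 1, div_mul_cancel₀ _ hd0R.ne']) (by rw [← hC X.bins m 0 2, div_mul_cancel₀ _ hd0R.ne'])
    (by rw [← hCsq X.bins 1]; ring) (by rw [← hC X.bins m 1 2, div_mul_cancel₀ _ hd1R.ne']; ring) (by rw [← hCsq X.bins 2]; ring)
  have hBv := norm_sum_smul_le_of_coords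
    ((Finset.univ.erase (cellIdx c.N₀ c.k₀ m)).filter (fun k => dist (c.zM k) (c.zM (cellIdx c.N₀ c.k₀ m)) ≤ (P.Rm : ℝ)))
    (fun k => 4 * ((cOf X.bins (nq c m k) : ℚ) : ℝ)) (fun k => c.zM (cellIdx c.N₀ c.k₀ m) - c.zM k) (β := (X.beta : ℝ))
    (by exact_mod_cast hβ0)
    (by
      rw [← hB_of_check c hD hsep P hRm X.bins m 0, ← hB_of_check c hD hsep P hRm X.bins m 1, ← hB_of_check c hD hsep P hRm X.bins m 2]
      exact_mod_cast hβ)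
  have hFv := norm_sum_smul_le_of_enclosures
    ((Finset.univ.erase (cellIdx c.N₀ c.k₀ m)).filter (fun k => dist (c.zM k) (c.zM (cellIdx c.N₀ c.k₀ m)) ≤ (P.Rm : ℝ)))
    (fun k => 2 * (-(1 / 2) * (dist (c.zM (cellIdx c.N₀ c.k₀ m)) (c.zM k) ^ 2)⁻¹ ^ 7 + (1 / 2) * (dist (c.zM (cellIdx c.N₀ c.k₀ m)) (c.zM k) ^ 2)⁻¹ ^ 4))
    (fun k => c.zM (cellIdx c.N₀ c.k₀ m) - c.zM k) (fun a => ((sumX c (termF c P a m) : ℚ) : ℝ)) (τ := ((tauOf c : ℚ) : ℝ))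
    (φ := (X.phiF : ℝ)) (by exact_mod_cast hφ0) (fun a => hF_enclosure c hD hsep P hRm m a)
    (by have := (Rat.cast_le (K := ℝ)).2 hφ; push_cast at this; exact this)
  have hC4 := hC4_of_check c hD hsep P hRm X.bins m
  -- inner range / Bregman facts at radius `s₀` (same local set: `(innerP P s0).Rm = P.Rm`)
  have hrangeI := hrange_of_check c hD hsep (P := innerP P s0) hRm hbinsI hcovI
  have hbregI := hbreg_of_check c hD hsep (P := innerP P s0) (by exact_mod_cast hs00) hRm hbinsI hcovI
  dsimp only [innerP, innerX] at hrangeI hbregI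
  -- ===== assembly =====
  exact not_moveUnstableCore_of_twoZone_data (s₀ := (s0 : ℝ)) (by exact_mod_cast hs00)
    (fun k => ((cOf XI.bins (nq c m k) : ℚ) : ℝ))
    (fun k => ((((binOf XI.bins (nq c m k)).map fun b : MoveBin => (b.rlo - s0) ^ 2).getD 0 : ℚ) : ℝ))
    (fun k => ((((binOf XI.bins (nq c m k)).map fun b : MoveBin => (b.rhi + s0) ^ 2).getD 0 : ℚ) : ℝ))
    (XI.beta : ℝ) (min ((sumX c (termC4 c P XI.bins m) : ℚ) : ℝ) 0) (XI.mu : ℝ) (min_le_right _ _) (by exact_mod_cast hμ0)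
    hrangeI hbregI hBI (by rw [← hC4I]; exact min_le_left _ _) hN₀
    (fun k => ((cOf X.bins (nq c m k) : ℚ) : ℝ))
    (fun k => ((((binOf X.bins (nq c m k)).map fun b : MoveBin => (b.rlo - P.s) ^ 2).getD 0 : ℚ) : ℝ))
    (fun k => ((((binOf X.bins (nq c m k)).map fun b : MoveBin => (b.rhi + P.s) ^ 2).getD 0 : ℚ) : ℝ))
    (X.lam : ℝ) (X.beta : ℝ) (X.phiF : ℝ) ((sumX c (termC4 c P X.bins m) : ℚ) : ℝ) (by exact_mod_cast hβ0)
    (hrange_of_check c hD hsep hRm hbins hcov) (hbreg_of_check c hD hsep hs0P.le hRm hbins hcov) hA hBv hFv hC4.le hLR hvertR hshellR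

end Summit.AtomisticToContinuum.Crystallization.Theorems.FrustratedLawDichotomyCellKitX

end
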